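import Literature.MathematicalPhysics.QuantumFieldTheory.ConformalBootstrap3D.MixedEvenTail
import HarnessLib

/-!
# Second-order (chord) box bounds for two-weight evaluations (rule (M2) for two-sign rows)

Topic `MathematicalPhysics/QuantumFieldTheory/ConformalBootstrap3D`; definitions + theorems only (no
named fact, no instance, no `sorry`).

`PointFunctionalChord` gives the SECOND-order box rule for the terms of ONE point functional
`Φ(E, j, s) = Σ_k w_k [v_k^{s} 𝒫_{E,j}(z_k, z̄_k) - u_k^{s} 𝒫_{E,j}(1-z_k, 1-z̄_k)]`: every signed piece
is `c · r^θ · ρ^η` in the box coordinates `(θ, η) ∈ [0,1]²`, the chord/tangent sandwich of `r^θ`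
(Bernoulli) replaces each factor by an affine bound on the safe side (`termChordPiece`), the resulting
minorant is BILINEAR in `(θ, η)`, and its minimum over the box is the least of four vertex values
(`termChordMin`, `termChordMin_le`); the loss is second order in the box widths, which is what makes
head cells near the extremal corner of a certificate certify at all (the corner rule's loss is first
order times `Σ_k |w_k| …`).  The rows of a VECTOR sum rule (the `O(N)` rows `V_S, V_T, V_A` of
Kos–Poland–Simmons-Duffin 2014, §2.1, eq. (2.9), pairing `φ[a⁻](F₋)` with `φ[a⁺](F₊)`) and the
off-diagonal / odd rows of the mixed `σ–ε` system are TWO-WEIGHT evaluations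
`twoWeightEval c d z z̄ s g = Σ_k (c_k v_k^{s} g(z_k, z̄_k) - d_k u_k^{s} g(1-z_k, 1-z̄_k))`
(`MixedEvenTail`: `sum45_eq_twoWeightEval`, `(c, d) = (w₃ + w₄, w₃ - w₄)`), for which the tree has only
the first-order corner rule `cornerBound₂_le`.  This file is the chord rule for them — the same pieces
with independent direct and reflected weights:

* `termChordBound₂ c d z z̄ j s_lo s_hi E_lo E_hi θ η` — the bilinear minorant; `termChordMin₂` — the
  least of its four vertex values (FOUR closed-form numbers per `(j, box)`, in the primitives the
  point readers already evaluate); `termChordBound₂_self` / `termChordMin₂_self` — `c = d = w` is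
  `termChordBound` / `termChordMin` (definitionally);
* `termChordBound₂_le`, `termChordMin₂_le` — **rule (M2) for two-weight terms**: under the side
  conditions of the one-functional rule (every node's four ratios `v^{s_hi-s_lo}`, `u^{s_hi-s_lo}`,
  `u^{(E_hi-E_lo)/2}`, `v^{(E_hi-E_lo)/2}` at least `1/2`),
  `termChordMin₂ ≤ twoWeightEval c d z z̄ s 𝒫_{E,j}` on the whole box `[s_lo, s_hi] × [E_lo, E_hi]`;
  `twoWeightEval_nonneg_of_chordMin₂` — box by box; `termChordMin₂_le_pair` — the `F₋/F₊` pair form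
  `termChordMin₂ (w₃+w₄) (w₃-w₄) … ≤ φ[w₃](F^{s}_{-}[𝒫_{E,j}]) + φ[w₄](F^{s}_{+}[𝒫_{E,j}])`.

No number of any client cell is asserted here.

References: M. Hogervorst, S. Rychkov, "Radial coordinates for conformal blocks", Phys. Rev. D 87
(2013) 106004, arXiv:1303.1111, §3 eq. (3.6) [key HogervorstRychkov2013] (term basis); F. Kos,
D. Poland, D. Simmons-Duffin, "Bootstrapping the O(N) vector models", JHEP 06 (2014) 091,
arXiv:1307.6856, §2.1 [key KosPolandSimmonsduffin2014ON] (two-sign rows); F. Kos, D. Poland,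
D. Simmons-Duffin, A. Vichi, "Bootstrapping the O(N) archipelago", JHEP 11 (2015) 106,
arXiv:1504.07997, §2 [key KosPolandSimmonsDuffinVichi2015] (mixed-correlator rows).
-/

noncomputable section

namespace Literature.MathematicalPhysics.QuantumFieldTheory.ConformalBootstrap3D

open Finset Set

/-! ### The bilinear minorant of a two-weight term -/

/-- The bilinear chord minorant of the two-weight term `twoWeightEval c d z z̄ s 𝒫_{E,j}` at box
coordinates `(θ, η)`: `s = s_lo + θ (s_hi - s_lo)`, `E = E_lo + η (E_hi - E_lo)`.  Direct piece of node
`k`: `c_k v_k^{s_lo} 𝒫_{E_lo,j}(z_k, z̄_k) · r^θ ρ^η` with `r = v_k^{s_hi-s_lo}`,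
`ρ = (z_k z̄_k)^{(E_hi-E_lo)/2}`; reflected piece: `-d_k u_k^{s_lo} 𝒫_{E_lo,j}(1-z_k, 1-z̄_k) · r'^θ ρ'^η`
with `r' = u_k^{s_hi-s_lo}`, `ρ' = ((1-z_k)(1-z̄_k))^{(E_hi-E_lo)/2}`; each replaced by its safe-side
affine minorant `termChordPiece`. [cite: HogervorstRychkov2013, §3 eq. (3.6)] -/
def termChordBound₂ {N : ℕ} (c d z zb : Fin N → ℝ) (j : ℕ) (slo shi Elo Ehi θ η : ℝ) : ℝ :=
  ∑ k, (termChordPiece (c k * (((1 - z k) * (1 - zb k)) ^ slo * zMono Elo j (z k) (zb k))) θ η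
        (((1 - z k) * (1 - zb k)) ^ (shi - slo)) ((z k * zb k) ^ ((Ehi - Elo) / 2))
      + termChordPiece (-(d k * ((z k * zb k) ^ slo * zMono Elo j (1 - z k) (1 - zb k)))) θ η
        ((z k * zb k) ^ (shi - slo)) (((1 - z k) * (1 - zb k)) ^ ((Ehi - Elo) / 2)))

/-- The chord number of a two-weight term on a box: the least of the four vertex values of the
bilinear minorant. [cite: HogervorstRychkov2013, §3 eq. (3.6)] -/
def termChordMin₂ {N : ℕ} (c d z zb : Fin N → ℝ) (j : ℕ) (slo shi Elo Ehi : ℝ) : ℝ :=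
  min (min (termChordBound₂ c d z zb j slo shi Elo Ehi 0 0)
      (termChordBound₂ c d z zb j slo shi Elo Ehi 1 0))
    (min (termChordBound₂ c d z zb j slo shi Elo Ehi 0 1)
      (termChordBound₂ c d z zb j slo shi Elo Ehi 1 1))

/-- Equal weights give the one-functional minorant `termChordBound`.
[cite: HogervorstRychkov2013, §3 eq. (3.6)] -/
theorem termChordBound₂_self {N : ℕ} (w z zb : Fin N → ℝ) (j : ℕ) (slo shi Elo Ehi θ η : ℝ) :
    termChordBound₂ w w z zb j slo shi Elo Ehi θ η = termChordBound w z zb j slo shi Elo Ehi θ η :=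
  rfl

/-- Equal weights give the one-functional chord number `termChordMin`.
[cite: HogervorstRychkov2013, §3 eq. (3.6)] -/
theorem termChordMin₂_self {N : ℕ} (w z zb : Fin N → ℝ) (j : ℕ) (slo shi Elo Ehi : ℝ) :
    termChordMin₂ w w z zb j slo shi Elo Ehi = termChordMin w z zb j slo shi Elo Ehi :=
  rfl

/-- Bilinear interpolation of the minorant from its four vertex values.
[cite: HogervorstRychkov2013, §3 eq. (3.6)] -/
theorem termChordBound₂_interp {N : ℕ} (c d z zb : Fin N → ℝ) (j : ℕ)
    (slo shi Elo Ehi θ η : ℝ) :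
    termChordBound₂ c d z zb j slo shi Elo Ehi θ η =
      (1 - θ) * (1 - η) * termChordBound₂ c d z zb j slo shi Elo Ehi 0 0
        + θ * (1 - η) * termChordBound₂ c d z zb j slo shi Elo Ehi 1 0
        + (1 - θ) * η * termChordBound₂ c d z zb j slo shi Elo Ehi 0 1
        + θ * η * termChordBound₂ c d z zb j slo shi Elo Ehi 1 1 := by
  simp only [termChordBound₂, Finset.mul_sum, ← Finset.sum_add_distrib]
  refine Finset.sum_congr rfl (fun k _ => ?_)
  rw [termChordPiece_interp _ θ η, termChordPiece_interp (-(d k * _)) θ η]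
  ring

/-! ### Rule (M2) for two-weight terms -/

/-- **The minorant at box coordinates.** Nodes in the open square, every node's four ratios `≥ 1/2`;
then for `(θ, η) ∈ [0,1]²`,
`termChordBound₂ … θ η ≤ twoWeightEval c d z z̄ (s_lo + θ (s_hi - s_lo)) 𝒫_{E_lo + η (E_hi - E_lo), j}`.
[cite: HogervorstRychkov2013, §3 eq. (3.6)] -/
theorem termChordBound₂_le {N : ℕ} (c d z zb : Fin N → ℝ)
    (hz : ∀ k, z k ∈ Ioo (0 : ℝ) 1) (hzb : ∀ k, zb k ∈ Ioo (0 : ℝ) 1) (j : ℕ)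
    {slo shi Elo Ehi θ η : ℝ}
    (hr : ∀ k, 1 / 2 ≤ ((1 - z k) * (1 - zb k)) ^ (shi - slo) ∧ 1 / 2 ≤ (z k * zb k) ^ (shi - slo))
    (hρ : ∀ k, 1 / 2 ≤ (z k * zb k) ^ ((Ehi - Elo) / 2) ∧
      1 / 2 ≤ ((1 - z k) * (1 - zb k)) ^ ((Ehi - Elo) / 2))
    (hθ : θ ∈ Icc (0 : ℝ) 1) (hη : η ∈ Icc (0 : ℝ) 1) :
    termChordBound₂ c d z zb j slo shi Elo Ehi θ η ≤
      twoWeightEval c d z zb (slo + θ * (shi - slo)) (zMono (Elo + η * (Ehi - Elo)) j) := by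
  unfold termChordBound₂ twoWeightEval
  refine Finset.sum_le_sum (fun k _ => ?_)
  have hzk := hz k; have hzbk := hzb k
  have hv : 0 < (1 - z k) * (1 - zb k) := mul_pos (by linarith [hzk.2]) (by linarith [hzbk.2])
  have hu : 0 < z k * zb k := mul_pos hzk.1 hzbk.1
  -- the two pieces
  have h1 := termChordPiece_le
    (c := c k * (((1 - z k) * (1 - zb k)) ^ slo * zMono Elo j (z k) (zb k)))
    (hr k).1 (hρ k).1 hθ.1 hθ.2 hη.1 hη.2
  have h2 := termChordPiece_le
    (c := -(d k * ((z k * zb k) ^ slo * zMono Elo j (1 - z k) (1 - zb k))))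
    (hr k).2 (hρ k).2 hθ.1 hθ.2 hη.1 hη.2
  -- the exact pieces in box coordinates
  have hvs : ((1 - z k) * (1 - zb k)) ^ (slo + θ * (shi - slo)) =
      ((1 - z k) * (1 - zb k)) ^ slo * (((1 - z k) * (1 - zb k)) ^ (shi - slo)) ^ θ := by
    rw [Real.rpow_add hv, ← Real.rpow_mul hv.le, mul_comm (shi - slo) θ]
  have hus : (z k * zb k) ^ (slo + θ * (shi - slo)) =
      (z k * zb k) ^ slo * ((z k * zb k) ^ (shi - slo)) ^ θ := by
    rw [Real.rpow_add hu, ← Real.rpow_mul hu.le, mul_comm (shi - slo) θ]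
  have hEd : zMono (Elo + η * (Ehi - Elo)) j (z k) (zb k) =
      zMono Elo j (z k) (zb k) * ((z k * zb k) ^ ((Ehi - Elo) / 2)) ^ η := by
    rw [zMono_add Elo _ j hzk.1 hzbk.1, ← Real.rpow_mul hu.le]
    congr 1; congr 1; ring
  have hEr : zMono (Elo + η * (Ehi - Elo)) j (1 - z k) (1 - zb k) =
      zMono Elo j (1 - z k) (1 - zb k) * (((1 - z k) * (1 - zb k)) ^ ((Ehi - Elo) / 2)) ^ η := by
    rw [zMono_add Elo _ j (by linarith [hzk.2]) (by linarith [hzbk.2]), ← Real.rpow_mul hv.le]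
    congr 1; congr 1; ring
  have key :
      termChordPiece (c k * (((1 - z k) * (1 - zb k)) ^ slo * zMono Elo j (z k) (zb k))) θ η
          (((1 - z k) * (1 - zb k)) ^ (shi - slo)) ((z k * zb k) ^ ((Ehi - Elo) / 2))
        + termChordPiece (-(d k * ((z k * zb k) ^ slo * zMono Elo j (1 - z k) (1 - zb k)))) θ η
          ((z k * zb k) ^ (shi - slo)) (((1 - z k) * (1 - zb k)) ^ ((Ehi - Elo) / 2)) ≤
      c k * (((1 - z k) * (1 - zb k)) ^ (slo + θ * (shi - slo)) *
          zMono (Elo + η * (Ehi - Elo)) j (z k) (zb k))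
        + -(d k * ((z k * zb k) ^ (slo + θ * (shi - slo)) *
          zMono (Elo + η * (Ehi - Elo)) j (1 - z k) (1 - zb k))) := by
    rw [hvs, hus, hEd, hEr]
    calc _ ≤ c k * (((1 - z k) * (1 - zb k)) ^ slo * zMono Elo j (z k) (zb k)) *
            ((((1 - z k) * (1 - zb k)) ^ (shi - slo)) ^ θ * ((z k * zb k) ^ ((Ehi - Elo) / 2)) ^ η)
          + -(d k * ((z k * zb k) ^ slo * zMono Elo j (1 - z k) (1 - zb k))) *
            (((z k * zb k) ^ (shi - slo)) ^ θ *
              (((1 - z k) * (1 - zb k)) ^ ((Ehi - Elo) / 2)) ^ η) :=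
          add_le_add h1 h2
      _ = _ := by ring
  refine key.trans (le_of_eq ?_)
  ring

/-- The least vertex value bounds the bilinear minorant on the box. [cite: HogervorstRychkov2013, §3 eq. (3.6)] -/
theorem termChordMin₂_le_termChordBound₂ {N : ℕ} (c d z zb : Fin N → ℝ) (j : ℕ)
    (slo shi Elo Ehi : ℝ) {θ η : ℝ} (hθ : θ ∈ Icc (0 : ℝ) 1) (hη : η ∈ Icc (0 : ℝ) 1) :
    termChordMin₂ c d z zb j slo shi Elo Ehi ≤ termChordBound₂ c d z zb j slo shi Elo Ehi θ η := by
  rw [termChordBound₂_interp]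
  set m := termChordMin₂ c d z zb j slo shi Elo Ehi with hm
  have h00 : m ≤ termChordBound₂ c d z zb j slo shi Elo Ehi 0 0 :=
    (min_le_left _ _).trans (min_le_left _ _)
  have h10 : m ≤ termChordBound₂ c d z zb j slo shi Elo Ehi 1 0 :=
    (min_le_left _ _).trans (min_le_right _ _)
  have h01 : m ≤ termChordBound₂ c d z zb j slo shi Elo Ehi 0 1 :=
    (min_le_right _ _).trans (min_le_left _ _)
  have h11 : m ≤ termChordBound₂ c d z zb j slo shi Elo Ehi 1 1 :=
    (min_le_right _ _).trans (min_le_right _ _)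
  have w00 : 0 ≤ (1 - θ) * (1 - η) := mul_nonneg (by linarith [hθ.2]) (by linarith [hη.2])
  have w10 : 0 ≤ θ * (1 - η) := mul_nonneg hθ.1 (by linarith [hη.2])
  have w01 : 0 ≤ (1 - θ) * η := mul_nonneg (by linarith [hθ.2]) hη.1
  have w11 : 0 ≤ θ * η := mul_nonneg hθ.1 hη.1
  have hsum : m = (1 - θ) * (1 - η) * m + θ * (1 - η) * m + (1 - θ) * η * m + θ * η * m := by ring
  rw [hsum]
  gcongr

/-- **Rule (M2) for two-weight terms: the chord number bounds the term on the whole box.** Nodes in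
the open square, node ratios `≥ 1/2`; then `termChordMin₂ ≤ twoWeightEval c d z z̄ s 𝒫_{E,j}` for all
`s ∈ [s_lo, s_hi]`, `E ∈ [E_lo, E_hi]`. [cite: HogervorstRychkov2013, §3 eq. (3.6)] -/
theorem termChordMin₂_le {N : ℕ} (c d z zb : Fin N → ℝ)
    (hz : ∀ k, z k ∈ Ioo (0 : ℝ) 1) (hzb : ∀ k, zb k ∈ Ioo (0 : ℝ) 1) (j : ℕ)
    {slo shi Elo Ehi : ℝ}
    (hr : ∀ k, 1 / 2 ≤ ((1 - z k) * (1 - zb k)) ^ (shi - slo) ∧ 1 / 2 ≤ (z k * zb k) ^ (shi - slo))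
    (hρ : ∀ k, 1 / 2 ≤ (z k * zb k) ^ ((Ehi - Elo) / 2) ∧
      1 / 2 ≤ ((1 - z k) * (1 - zb k)) ^ ((Ehi - Elo) / 2))
    {s E : ℝ} (hs : s ∈ Icc slo shi) (hE : E ∈ Icc Elo Ehi) :
    termChordMin₂ c d z zb j slo shi Elo Ehi ≤ twoWeightEval c d z zb s (zMono E j) := by
  -- box coordinates
  obtain ⟨θ, hθ, hsθ⟩ : ∃ θ : ℝ, θ ∈ Icc (0 : ℝ) 1 ∧ s = slo + θ * (shi - slo) := by
    rcases eq_or_lt_of_le (hs.1.trans hs.2) with h | h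
    · exact ⟨0, ⟨le_rfl, zero_le_one⟩, by simp; linarith [hs.1, hs.2]⟩
    · have hne : shi - slo ≠ 0 := ne_of_gt (sub_pos.2 h)
      refine ⟨(s - slo) / (shi - slo), ⟨div_nonneg (by linarith [hs.1]) (by linarith),
        (div_le_one (by linarith)).2 (by linarith [hs.2])⟩, ?_⟩
      rw [div_mul_cancel₀ _ hne]; ring
  obtain ⟨η, hη, hEη⟩ : ∃ η : ℝ, η ∈ Icc (0 : ℝ) 1 ∧ E = Elo + η * (Ehi - Elo) := by
    rcases eq_or_lt_of_le (hE.1.trans hE.2) with h | h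
    · exact ⟨0, ⟨le_rfl, zero_le_one⟩, by simp; linarith [hE.1, hE.2]⟩
    · have hne : Ehi - Elo ≠ 0 := ne_of_gt (sub_pos.2 h)
      refine ⟨(E - Elo) / (Ehi - Elo), ⟨div_nonneg (by linarith [hE.1]) (by linarith),
        (div_le_one (by linarith)).2 (by linarith [hE.2])⟩, ?_⟩
      rw [div_mul_cancel₀ _ hne]; ring
  rw [hsθ, hEη]
  exact (termChordMin₂_le_termChordBound₂ c d z zb j slo shi Elo Ehi hθ hη).trans
    (termChordBound₂_le c d z zb hz hzb j hr hρ hθ hη)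

/-- **(M2) box by box for two-weight terms.** `0 ≤ termChordMin₂` on a box gives termwise positivity
on it. [cite: HogervorstRychkov2013, §3 eq. (3.6)] -/
theorem twoWeightEval_nonneg_of_chordMin₂ {N : ℕ} (c d z zb : Fin N → ℝ)
    (hz : ∀ k, z k ∈ Ioo (0 : ℝ) 1) (hzb : ∀ k, zb k ∈ Ioo (0 : ℝ) 1) (j : ℕ)
    {slo shi Elo Ehi : ℝ}
    (hr : ∀ k, 1 / 2 ≤ ((1 - z k) * (1 - zb k)) ^ (shi - slo) ∧ 1 / 2 ≤ (z k * zb k) ^ (shi - slo))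
    (hρ : ∀ k, 1 / 2 ≤ (z k * zb k) ^ ((Ehi - Elo) / 2) ∧
      1 / 2 ≤ ((1 - z k) * (1 - zb k)) ^ ((Ehi - Elo) / 2))
    (h : 0 ≤ termChordMin₂ c d z zb j slo shi Elo Ehi) :
    ∀ E ∈ Icc Elo Ehi, ∀ s ∈ Icc slo shi, 0 ≤ twoWeightEval c d z zb s (zMono E j) :=
  fun _ hE _ hs => h.trans (termChordMin₂_le c d z zb hz hzb j hr hρ hs hE)

/-- **The `F₋/F₊` pair form.** For a row `g ↦ φ[w₃](F^{s}_{-}[g]) + φ[w₄](F^{s}_{+}[g])` (the two-sign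
rows of a vector sum rule; the off-diagonal even and the odd rows of the mixed `σ–ε` system) the chord
number with `(c, d) = (w₃ + w₄, w₃ - w₄)` bounds the term on the box.
[cite: KosPolandSimmonsduffin2014ON, §2.1] -/
theorem termChordMin₂_le_pair {N : ℕ} (w₃ w₄ z zb : Fin N → ℝ)
    (hz : ∀ k, z k ∈ Ioo (0 : ℝ) 1) (hzb : ∀ k, zb k ∈ Ioo (0 : ℝ) 1) (j : ℕ)
    {slo shi Elo Ehi : ℝ}
    (hr : ∀ k, 1 / 2 ≤ ((1 - z k) * (1 - zb k)) ^ (shi - slo) ∧ 1 / 2 ≤ (z k * zb k) ^ (shi - slo))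
    (hρ : ∀ k, 1 / 2 ≤ (z k * zb k) ^ ((Ehi - Elo) / 2) ∧
      1 / 2 ≤ ((1 - z k) * (1 - zb k)) ^ ((Ehi - Elo) / 2))
    {s E : ℝ} (hs : s ∈ Icc slo shi) (hE : E ∈ Icc Elo Ehi) :
    termChordMin₂ (w₃ + w₄) (w₃ - w₄) z zb j slo shi Elo Ehi ≤
      pointFunctional w₃ z zb (crossF s (-1) (zMono E j)) +
        pointFunctional w₄ z zb (crossF s 1 (zMono E j)) := by
  rw [sum45_eq_twoWeightEval]
  exact termChordMin₂_le (w₃ + w₄) (w₃ - w₄) z zb hz hzb j hr hρ hs hE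

end Literature.MathematicalPhysics.QuantumFieldTheory.ConformalBootstrap3D
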